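import Summits.Ventures.LatticeQCDFlow.Scaling.StarCycleSupersolution

/-!
HONEST FRAMING: exact (Metropolis-corrected) sampling algorithms for lattice gauge theory; figures
of merit are autocorrelation/cost numbers at stated couplings and volumes; no continuum-physics
claim.

# StarSyncIdleBracket — `Q·F` AND `M'·F` FOR THE SYNCHRONOUS COUPLING OF THE PERSISTENT HUB WITH IDLE COLD LEVELS: SUPER-HARMONICITY
# `(1−t)w_0·Ψ + M'·F ≤ F` IS THE FINITE LIST OF BRACKET INEQUALITIES `(1−t)w_0·Ψ(a) + Σ_r (t/m)·SW_r(F)(a) ≤ (t + (1−t)w_0)·F(a)` (lean-2 GEN-32, ours)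

Venture-side (OURS).  Cell `lqcd-flow` (pub-lqcd), unit `pub-lqcd-lean-2-g32`, 2026-08-29.  Chapter S, file 2, companion of `StarCycleSupersolution`.  For the synchronous
coupling `Q` of `StarSyncCoupling` (any `K`, any finite content space `S`, any entry bijections `φ_r`, exact hot redraws `M_0(u,·) = μ_0`) with IDLE cold levels
`M_k(u,·) = δ_u` (`k ≥ 1`) — the setting of chapter R and of `lean-2/MEMO-gen31-coupling-certificate.md` — and every test function `F` on pairs:
`(Q·F)(a) = Σ_r (t/m)·SW_r(F)(a) + (1−t)·(w_0·(R·F)(a) + (Σ_{k≥1} w_k)·F(a))` where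
`SW_r(F)(a) = min(α_r(a.1),α_r(a.2))·F(e_r a.1, e_r a.2) + (α_r(a.1)−min)·F(e_r a.1, a.2) + (α_r(a.2)−min)·F(a.1, e_r a.2) + (1−α_r(a.1)−α_r(a.2)+min)·F(a)` is the synchronous
swap bracket of entry `r` (`e_r` the edge swap through `φ_r`) and `R` the shared redraw kernel; hence `(M'·F)(a) = Σ_r (t/m)·SW_r(F)(a) + (1−t)(1−w_0)·F(a)` for
`M' = Q − (1−t)w_0·R`, and the super-harmonicity hypothesis of `starCycle_mixingTime_le_of_supersolution` is equivalent to the bracket inequalities of the title.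
Hypothesis-equations throughout; no definitions.

## What is proved

* §1 `pair_pointMass_sum`, `pair_weighted_pointMass_sum`, `starSyncSwap_mulVec_bracket` (point masses and the swap bracket against a test function), `idle_coordKernel_eq`,
  `idle_coordKernel_prod_sum`, `idle_sharedUpdate_sum` (an idle level never moves a pair), `starSync_redraw_mulVec_apply` (`(R·F)(a) = Σ_v μ_0(v)F(a.1[0↦v],a.2[0↦v])`),
  **`starSync_idle_mulVec_apply`** (the `Q·F` formula),
  **`starSync_idle_rest_mulVec_apply`** (the `M'·F` formula, `Σ_k w_k = 1`), **`starSync_idle_supersolution_of`** (bracket inequalities ⇒ `(1−t)w_0·Ψ + M'·F ≤ F`).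
* §2 **`starCycle_mixingTime_le_of_idle_supersolution`** — exact hot redraws, idle cold levels, `0 ≤ Ψ ≤ Ψ_max` with `Ψ ≥ 1` where a cold level differs, `F ≥ 0` with the
  bracket inequalities and `R·F ≤ (1−ρ)·Ψ` (`0 < ρ ≤ 1`, `0 ≤ t < 1`, `w_0 > 0`) ⇒ `t_mix(ε) ≤ ⌈(4/((1−t)·w_0·ρ))·log((e·Ψ_max + 1)/ε)⌉₊`.

Reading (no numerics implied): this is the checklist a certificate for OPEN-MATH item 1 has to pass; `Scaling/BooleanTwoLevelCertificate` (this generation) passes it for `K = 1`.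
NOT CLAIMED: any certificate for `K ≥ 2`; anything measured.  Literature grade (cell rule): OWN, elementary; nothing cited as a fact; no new bib keys.
-/

noncomputable section

open Finset Function Matrix
open Literature.Probability.MarkovChains

namespace Summit.Ventures.LatticeQCDFlow.Scaling

/-! ## §1 `Q·F` for the synchronous coupling with idle cold levels -/

section Idle
variable {K m : ℕ} {S : Type*} [Fintype S] [DecidableEq S] {μ : Fin (K + 1) → S → ℝ} {M : Fin (K + 1) → S → S → ℝ} {w : Fin (K + 1) → ℝ} {t : ℝ}
variable (κ : Fin m → Fin K) (φ : Fin m → S ≃ S)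

/-- `Σ_b 𝟙{b = (X,Y)}·F(b) = F(X,Y)` on the pair space. [ours] -/
theorem pair_pointMass_sum {A : Type*} [Fintype A] [DecidableEq A] (X Y : A) (F : A × A → ℝ) :
    ∑ b : A × A, (if b.1 = X ∧ b.2 = Y then (1 : ℝ) else 0) * F b = F (X, Y) := by
  rw [Finset.sum_eq_single (X, Y)]
  · rw [if_pos ⟨rfl, rfl⟩, one_mul]
  · rintro b _ hb
    rw [if_neg (fun h => hb (Prod.ext h.1 h.2)), zero_mul]
  · intro h; exact absurd (mem_univ _) h

/-- `Σ_b (Σ_v g(v)·𝟙{b = (f v, f' v)})·F(b) = Σ_v g(v)·F(f v, f' v)`. [ours] -/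
theorem pair_weighted_pointMass_sum {A V : Type*} [Fintype A] [DecidableEq A] [Fintype V] (g : V → ℝ) (f f' : V → A) (F : A × A → ℝ) :
    ∑ b : A × A, (∑ v : V, g v * (if b.1 = f v ∧ b.2 = f' v then (1 : ℝ) else 0)) * F b = ∑ v : V, g v * F (f v, f' v) := by
  simp_rw [Finset.sum_mul]
  rw [Finset.sum_comm]
  refine sum_congr rfl fun v _ => ?_
  simp_rw [mul_assoc]
  rw [← Finset.mul_sum, pair_pointMass_sum]

/-- **The synchronous swap bracket against a test function:** `Σ_b [min·𝟙{b=(ex,ey)} + (α_x−min)·𝟙{b=(ex,y)} + (α_y−min)·𝟙{b=(x,ey)} + (1−α_x−α_y+min)·𝟙{b=(x,y)}]·F(b)`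
`= min·F(ex,ey) + (α_x−min)·F(ex,y) + (α_y−min)·F(x,ey) + (1−α_x−α_y+min)·F(x,y)`. [ours] -/
theorem starSyncSwap_mulVec_bracket {A : Type*} [Fintype A] [DecidableEq A] (αx αy : ℝ) (x y ex ey : A) (F : A × A → ℝ) :
    ∑ b : A × A, (min αx αy * (if b.1 = ex ∧ b.2 = ey then (1 : ℝ) else 0)
        + (αx - min αx αy) * (if b.1 = ex ∧ b.2 = y then (1 : ℝ) else 0)
        + (αy - min αx αy) * (if b.1 = x ∧ b.2 = ey then (1 : ℝ) else 0)
        + (1 - αx - αy + min αx αy) * (if b.1 = x ∧ b.2 = y then (1 : ℝ) else 0)) * F b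
      = min αx αy * F (ex, ey) + (αx - min αx αy) * F (ex, y) + (αy - min αx αy) * F (x, ey)
        + (1 - αx - αy + min αx αy) * F (x, y) := by
  simp only [add_mul, Finset.sum_add_distrib, mul_assoc, ← Finset.mul_sum, pair_pointMass_sum]

omit [Fintype S] in
/-- **An idle single-coordinate kernel is the identity:** `M_k(u,·) = δ_u` ⇒ `P̃_k(x,z) = 𝟙{z = x}`. [ours] -/
theorem idle_coordKernel_eq (k : Fin (K + 1)) (hidle : ∀ u v, M k u v = if v = u then 1 else 0) (x z : Fin (K + 1) → S) :
    coordKernel M k x z = if z = x then (1 : ℝ) else 0 := by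
  unfold coordKernel
  by_cases hz : z = update x k (z k)
  · rw [if_pos hz, hidle]
    by_cases hzk : z k = x k
    · rw [if_pos hzk, if_pos]
      rw [hz, hzk, update_eq_self]
    · rw [if_neg hzk, if_neg]
      intro h; exact hzk (by rw [h])
  · rw [if_neg hz, if_neg]
    intro h; apply hz; rw [h, update_eq_self]

/-- With an idle kernel at level `k`, the independent product move is the identity on pairs: `Σ_b P̃_k(x,b.1)·P̃_k(y,b.2)·F(b) = F(x,y)`. [ours] -/
theorem idle_coordKernel_prod_sum (k : Fin (K + 1)) (hidle : ∀ u v, M k u v = if v = u then 1 else 0) (x y : Fin (K + 1) → S)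
    (F : (Fin (K + 1) → S) × (Fin (K + 1) → S) → ℝ) :
    ∑ b : (Fin (K + 1) → S) × (Fin (K + 1) → S), coordKernel M k x b.1 * coordKernel M k y b.2 * F b = F (x, y) := by
  have h1 : ∀ b : (Fin (K + 1) → S) × (Fin (K + 1) → S), coordKernel M k x b.1 * coordKernel M k y b.2
      = if b.1 = x ∧ b.2 = y then (1 : ℝ) else 0 := by
    intro b
    rw [idle_coordKernel_eq k hidle, idle_coordKernel_eq k hidle]
    by_cases hb1 : b.1 = x <;> by_cases hb2 : b.2 = y <;> simp [hb1, hb2]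
  simp_rw [h1]
  exact pair_pointMass_sum x y F

/-- With an idle kernel at a level `k` where the pair agrees, the shared move is the identity on pairs: `Σ_v M_k(x_k,v)·F(x[k↦v], y[k↦v]) = F(x,y)`. [ours] -/
theorem idle_sharedUpdate_sum (k : Fin (K + 1)) (hidle : ∀ u v, M k u v = if v = u then 1 else 0) (x y : Fin (K + 1) → S)
    (hxy : x k = y k) (F : (Fin (K + 1) → S) × (Fin (K + 1) → S) → ℝ) :
    ∑ v : S, M k (x k) v * F (update x k v, update y k v) = F (x, y) := by
  simp_rw [hidle]
  simp only [ite_mul, one_mul, zero_mul, Finset.sum_ite_eq' univ (x k), mem_univ, if_true]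
  rw [update_eq_self, hxy, update_eq_self]

/-- **The shared redraw kernel against a test function:** `(R·F)(a) = Σ_v μ_0(v)·F(a.1[0↦v], a.2[0↦v])`. [ours] -/
theorem starSync_redraw_mulVec_apply
    {R : (Fin (K + 1) → S) × (Fin (K + 1) → S) → (Fin (K + 1) → S) × (Fin (K + 1) → S) → ℝ}
    (hR : ∀ a b, R a b = ∑ v : S, μ 0 v * (if b.1 = update a.1 0 v ∧ b.2 = update a.2 0 v then (1 : ℝ) else 0))
    (F : (Fin (K + 1) → S) × (Fin (K + 1) → S) → ℝ) (a : (Fin (K + 1) → S) × (Fin (K + 1) → S)) :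
    (Matrix.mulVec (fun a b => R a b) F) a = ∑ v : S, μ 0 v * F (update a.1 0 v, update a.2 0 v) := by
  simp only [Matrix.mulVec, dotProduct]
  simp_rw [hR]
  exact pair_weighted_pointMass_sum (μ 0) (fun v => update a.1 0 v) (fun v => update a.2 0 v) F

/-- **`Q·F` FOR THE SYNCHRONOUS COUPLING WITH IDLE COLD LEVELS AND EXACT HOT REDRAWS:** for every test function `F` on pairs and every pair `a`,
`(Q·F)(a) = Σ_r (t/m)·SW_r(F)(a) + (1−t)·(w_0·(R·F)(a) + (Σ_{k≥1} w_k)·F(a))`, where `SW_r(F)(a)` is the synchronous swap bracket of entry `r` and `R` the shared redraw kernel.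
[ours] -/
theorem starSync_idle_mulVec_apply (hM0 : ∀ u v, M 0 u v = μ 0 v) (hidle : ∀ i : Fin K, ∀ u v, M i.succ u v = if v = u then 1 else 0)
    {α : Fin m → (Fin (K + 1) → S) → ℝ}
    {Q : (Fin (K + 1) → S) × (Fin (K + 1) → S) → (Fin (K + 1) → S) × (Fin (K + 1) → S) → ℝ}
    (hQ : ∀ a b, Q a b =
      ∑ r : Fin m, t / m *
        (min (α r a.1) (α r a.2) * (if b.1 = edgeFlowSwap (φ r) 0 (κ r).succ a.1
              ∧ b.2 = edgeFlowSwap (φ r) 0 (κ r).succ a.2 then (1 : ℝ) else 0)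
          + (α r a.1 - min (α r a.1) (α r a.2)) * (if b.1 = edgeFlowSwap (φ r) 0 (κ r).succ a.1 ∧ b.2 = a.2
              then (1 : ℝ) else 0)
          + (α r a.2 - min (α r a.1) (α r a.2)) * (if b.1 = a.1 ∧ b.2 = edgeFlowSwap (φ r) 0 (κ r).succ a.2
              then (1 : ℝ) else 0)
          + (1 - α r a.1 - α r a.2 + min (α r a.1) (α r a.2)) * (if b.1 = a.1 ∧ b.2 = a.2 then (1 : ℝ) else 0))
      + (1 - t) * ∑ k : Fin (K + 1), w k *
        (if a.1 k = a.2 k ∨ k = 0 then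
            ∑ v : S, M k (a.1 k) v * (if b.1 = update a.1 k v ∧ b.2 = update a.2 k v then (1 : ℝ) else 0)
          else coordKernel M k a.1 b.1 * coordKernel M k a.2 b.2))
    {R : (Fin (K + 1) → S) × (Fin (K + 1) → S) → (Fin (K + 1) → S) × (Fin (K + 1) → S) → ℝ}
    (hR : ∀ a b, R a b = ∑ v : S, μ 0 v * (if b.1 = update a.1 0 v ∧ b.2 = update a.2 0 v then (1 : ℝ) else 0))
    (F : (Fin (K + 1) → S) × (Fin (K + 1) → S) → ℝ) (a : (Fin (K + 1) → S) × (Fin (K + 1) → S)) :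
    (Matrix.mulVec (fun a b => Q a b) F) a
      = ∑ r : Fin m, t / m *
          (min (α r a.1) (α r a.2) * F (edgeFlowSwap (φ r) 0 (κ r).succ a.1, edgeFlowSwap (φ r) 0 (κ r).succ a.2)
            + (α r a.1 - min (α r a.1) (α r a.2)) * F (edgeFlowSwap (φ r) 0 (κ r).succ a.1, a.2)
            + (α r a.2 - min (α r a.1) (α r a.2)) * F (a.1, edgeFlowSwap (φ r) 0 (κ r).succ a.2)
            + (1 - α r a.1 - α r a.2 + min (α r a.1) (α r a.2)) * F (a.1, a.2))
        + (1 - t) * (w 0 * (Matrix.mulVec (fun a b => R a b) F) a + (∑ i : Fin K, w i.succ) * F a) := by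
  -- the redraw kernel against `F`
  have hRF := starSync_redraw_mulVec_apply hR F a
  -- the cold/hub update part against `F`, level by level
  have hU : ∀ k : Fin (K + 1), ∑ b : (Fin (K + 1) → S) × (Fin (K + 1) → S),
      (if a.1 k = a.2 k ∨ k = 0 then
          ∑ v : S, M k (a.1 k) v * (if b.1 = update a.1 k v ∧ b.2 = update a.2 k v then (1 : ℝ) else 0)
        else coordKernel M k a.1 b.1 * coordKernel M k a.2 b.2) * F b
      = if k = 0 then ∑ v : S, μ 0 v * F (update a.1 0 v, update a.2 0 v) else F a := by
    intro k
    by_cases hk : k = 0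
    · subst hk
      simp only [or_true, if_true]
      rw [pair_weighted_pointMass_sum]
      simp_rw [hM0]
    · rw [if_neg hk]
      obtain ⟨i, rfl⟩ := Fin.eq_succ_of_ne_zero hk
      by_cases hag : a.1 i.succ = a.2 i.succ
      · have hc : (a.1 i.succ = a.2 i.succ ∨ i.succ = 0) := Or.inl hag
        simp only [hc, if_true]
        rw [pair_weighted_pointMass_sum, idle_sharedUpdate_sum i.succ (hidle i) a.1 a.2 hag F]
      · have hc : ¬ (a.1 i.succ = a.2 i.succ ∨ i.succ = 0) := fun h => h.elim hag (Fin.succ_ne_zero i)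
        simp only [hc, if_false]
        exact idle_coordKernel_prod_sum i.succ (hidle i) a.1 a.2 F
  -- assemble
  have hmain : (Matrix.mulVec (fun a b => Q a b) F) a = ∑ b, Q a b * F b := rfl
  rw [hmain]
  simp_rw [hQ]
  rw [Finset.sum_congr rfl (fun b _ => add_mul _ _ (F b)), Finset.sum_add_distrib]
  congr 1
  · -- swap part
    simp_rw [Finset.sum_mul]
    rw [Finset.sum_comm]
    refine sum_congr rfl fun r _ => ?_
    simp_rw [mul_assoc]
    rw [← Finset.mul_sum, starSyncSwap_mulVec_bracket]
  · -- update part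
    simp_rw [mul_assoc]
    rw [← Finset.mul_sum]
    congr 1
    simp_rw [Finset.sum_mul, mul_assoc]
    rw [Finset.sum_comm]
    simp_rw [← Finset.mul_sum]
    simp_rw [hU]
    rw [Fin.sum_univ_succ]
    simp only [if_true, Fin.succ_ne_zero, if_false]
    rw [hRF]

/-- **`M'·F` WITH IDLE COLD LEVELS:** `(M'·F)(a) = Σ_r (t/m)·SW_r(F)(a) + (1−t)·(1−w_0)·F(a)` for `M' = Q − (1−t)w_0·R` (`Σ_k w_k = 1`). [ours] -/
theorem starSync_idle_rest_mulVec_apply (hw1 : ∑ k, w k = 1) (hM0 : ∀ u v, M 0 u v = μ 0 v)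
    (hidle : ∀ i : Fin K, ∀ u v, M i.succ u v = if v = u then 1 else 0)
    {α : Fin m → (Fin (K + 1) → S) → ℝ}
    {Q : (Fin (K + 1) → S) × (Fin (K + 1) → S) → (Fin (K + 1) → S) × (Fin (K + 1) → S) → ℝ}
    (hQ : ∀ a b, Q a b =
      ∑ r : Fin m, t / m *
        (min (α r a.1) (α r a.2) * (if b.1 = edgeFlowSwap (φ r) 0 (κ r).succ a.1
              ∧ b.2 = edgeFlowSwap (φ r) 0 (κ r).succ a.2 then (1 : ℝ) else 0)
          + (α r a.1 - min (α r a.1) (α r a.2)) * (if b.1 = edgeFlowSwap (φ r) 0 (κ r).succ a.1 ∧ b.2 = a.2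
              then (1 : ℝ) else 0)
          + (α r a.2 - min (α r a.1) (α r a.2)) * (if b.1 = a.1 ∧ b.2 = edgeFlowSwap (φ r) 0 (κ r).succ a.2
              then (1 : ℝ) else 0)
          + (1 - α r a.1 - α r a.2 + min (α r a.1) (α r a.2)) * (if b.1 = a.1 ∧ b.2 = a.2 then (1 : ℝ) else 0))
      + (1 - t) * ∑ k : Fin (K + 1), w k *
        (if a.1 k = a.2 k ∨ k = 0 then
            ∑ v : S, M k (a.1 k) v * (if b.1 = update a.1 k v ∧ b.2 = update a.2 k v then (1 : ℝ) else 0)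
          else coordKernel M k a.1 b.1 * coordKernel M k a.2 b.2))
    {R : (Fin (K + 1) → S) × (Fin (K + 1) → S) → (Fin (K + 1) → S) × (Fin (K + 1) → S) → ℝ}
    (hR : ∀ a b, R a b = ∑ v : S, μ 0 v * (if b.1 = update a.1 0 v ∧ b.2 = update a.2 0 v then (1 : ℝ) else 0))
    {M' : (Fin (K + 1) → S) × (Fin (K + 1) → S) → (Fin (K + 1) → S) × (Fin (K + 1) → S) → ℝ}
    (hM' : ∀ a b, M' a b = Q a b - (1 - t) * w 0 * R a b)
    (F : (Fin (K + 1) → S) × (Fin (K + 1) → S) → ℝ) (a : (Fin (K + 1) → S) × (Fin (K + 1) → S)) :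
    (Matrix.mulVec (fun a b => M' a b) F) a
      = ∑ r : Fin m, t / m *
          (min (α r a.1) (α r a.2) * F (edgeFlowSwap (φ r) 0 (κ r).succ a.1, edgeFlowSwap (φ r) 0 (κ r).succ a.2)
            + (α r a.1 - min (α r a.1) (α r a.2)) * F (edgeFlowSwap (φ r) 0 (κ r).succ a.1, a.2)
            + (α r a.2 - min (α r a.1) (α r a.2)) * F (a.1, edgeFlowSwap (φ r) 0 (κ r).succ a.2)
            + (1 - α r a.1 - α r a.2 + min (α r a.1) (α r a.2)) * F (a.1, a.2))
        + (1 - t) * (1 - w 0) * F a := by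
  have hsplit : (Matrix.mulVec (fun a b => M' a b) F) a
      = (Matrix.mulVec (fun a b => Q a b) F) a - (1 - t) * w 0 * (Matrix.mulVec (fun a b => R a b) F) a := by
    simp only [Matrix.mulVec, dotProduct]
    simp_rw [hM', sub_mul, Finset.sum_sub_distrib, mul_assoc, ← Finset.mul_sum]
  have hw : ∑ i : Fin K, w i.succ = 1 - w 0 := by
    have := hw1; rw [Fin.sum_univ_succ] at this; linarith
  rw [hsplit, starSync_idle_mulVec_apply κ φ hM0 hidle hQ hR F a, hw]
  ring

/-- **THE BRACKET FORM OF SUPER-HARMONICITY (idle cold levels):** if for every pair `a`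
`(1−t)w_0·Ψ(a) + Σ_r (t/m)·SW_r(F)(a) ≤ (t + (1−t)w_0)·F(a)`, then `(1−t)w_0·Ψ + M'·F ≤ F` pointwise. [ours] -/
theorem starSync_idle_supersolution_of (hw1 : ∑ k, w k = 1) (hM0 : ∀ u v, M 0 u v = μ 0 v)
    (hidle : ∀ i : Fin K, ∀ u v, M i.succ u v = if v = u then 1 else 0)
    {α : Fin m → (Fin (K + 1) → S) → ℝ}
    {Q : (Fin (K + 1) → S) × (Fin (K + 1) → S) → (Fin (K + 1) → S) × (Fin (K + 1) → S) → ℝ}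
    (hQ : ∀ a b, Q a b =
      ∑ r : Fin m, t / m *
        (min (α r a.1) (α r a.2) * (if b.1 = edgeFlowSwap (φ r) 0 (κ r).succ a.1
              ∧ b.2 = edgeFlowSwap (φ r) 0 (κ r).succ a.2 then (1 : ℝ) else 0)
          + (α r a.1 - min (α r a.1) (α r a.2)) * (if b.1 = edgeFlowSwap (φ r) 0 (κ r).succ a.1 ∧ b.2 = a.2
              then (1 : ℝ) else 0)
          + (α r a.2 - min (α r a.1) (α r a.2)) * (if b.1 = a.1 ∧ b.2 = edgeFlowSwap (φ r) 0 (κ r).succ a.2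
              then (1 : ℝ) else 0)
          + (1 - α r a.1 - α r a.2 + min (α r a.1) (α r a.2)) * (if b.1 = a.1 ∧ b.2 = a.2 then (1 : ℝ) else 0))
      + (1 - t) * ∑ k : Fin (K + 1), w k *
        (if a.1 k = a.2 k ∨ k = 0 then
            ∑ v : S, M k (a.1 k) v * (if b.1 = update a.1 k v ∧ b.2 = update a.2 k v then (1 : ℝ) else 0)
          else coordKernel M k a.1 b.1 * coordKernel M k a.2 b.2))
    {R : (Fin (K + 1) → S) × (Fin (K + 1) → S) → (Fin (K + 1) → S) × (Fin (K + 1) → S) → ℝ}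
    (hR : ∀ a b, R a b = ∑ v : S, μ 0 v * (if b.1 = update a.1 0 v ∧ b.2 = update a.2 0 v then (1 : ℝ) else 0))
    {M' : (Fin (K + 1) → S) × (Fin (K + 1) → S) → (Fin (K + 1) → S) × (Fin (K + 1) → S) → ℝ}
    (hM' : ∀ a b, M' a b = Q a b - (1 - t) * w 0 * R a b)
    {Ψ F : (Fin (K + 1) → S) × (Fin (K + 1) → S) → ℝ}
    (hbr : ∀ a : (Fin (K + 1) → S) × (Fin (K + 1) → S),
      (1 - t) * w 0 * Ψ a
        + ∑ r : Fin m, t / m *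
          (min (α r a.1) (α r a.2) * F (edgeFlowSwap (φ r) 0 (κ r).succ a.1, edgeFlowSwap (φ r) 0 (κ r).succ a.2)
            + (α r a.1 - min (α r a.1) (α r a.2)) * F (edgeFlowSwap (φ r) 0 (κ r).succ a.1, a.2)
            + (α r a.2 - min (α r a.1) (α r a.2)) * F (a.1, edgeFlowSwap (φ r) 0 (κ r).succ a.2)
            + (1 - α r a.1 - α r a.2 + min (α r a.1) (α r a.2)) * F (a.1, a.2))
      ≤ (t + (1 - t) * w 0) * F a)
    (a : (Fin (K + 1) → S) × (Fin (K + 1) → S)) :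
    (1 - t) * w 0 * Ψ a + (Matrix.mulVec (fun a b => M' a b) F) a ≤ F a := by
  rw [starSync_idle_rest_mulVec_apply κ φ hw1 hM0 hidle hQ hR hM' F a]
  have h1 := hbr a
  have e : (t + (1 - t) * w 0) * F a + (1 - t) * (1 - w 0) * F a = F a := by ring
  linarith

end Idle

/-! ## §2 The mixing time from a bracket-form supersolution -/

section Law
variable {K m : ℕ} {S : Type*} [Fintype S] [DecidableEq S] {μ : Fin (K + 1) → S → ℝ} {M : Fin (K + 1) → S → S → ℝ} {w : Fin (K + 1) → ℝ} {t : ℝ}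
variable (κ : Fin m → Fin K) (φ : Fin m → S ≃ S)

/-- **IDLE COLD LEVELS, BRACKET FORM:** exact hot redraws, idle cold kernels `M_k(u,·) = δ_u` (`k ≥ 1`), a potential `0 ≤ Ψ ≤ Ψ_max` with `Ψ ≥ 1` where a cold level
differs, and `F ≥ 0` on pairs with `(1−t)w_0·Ψ(a) + Σ_r (t/m)·SW_r(F)(a) ≤ (t + (1−t)w_0)·F(a)` and `(R·F)(a) ≤ (1−ρ)·Ψ(a)` for every pair `a` (`0 < ρ ≤ 1`, `0 ≤ t < 1`,
`w_0 > 0`) ⇒ **`t_mix(ε) ≤ ⌈(4/((1−t)·w_0·ρ))·log((e·Ψ_max + 1)/ε)⌉₊`**. [ours] -/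
theorem starCycle_mixingTime_le_of_idle_supersolution [Nonempty S] (hm : 1 ≤ m) (ht0 : 0 ≤ t) (ht1 : t < 1) (hw0 : ∀ k, 0 ≤ w k)
    (hw00 : 0 < w 0) (hw1 : ∑ k, w k = 1) (hμ : ∀ k x, 0 < μ k x) (hμ1 : ∀ k, ∑ u, μ k u = 1) (hM : ∀ k, IsRowStochastic (M k))
    (hMrev : ∀ k, DetailedBalance (μ k) (M k)) (hM0 : ∀ u v, M 0 u v = μ 0 v)
    (hidle : ∀ i : Fin K, ∀ u v, M i.succ u v = if v = u then 1 else 0)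
    {α : Fin m → (Fin (K + 1) → S) → ℝ}
    (hα : ∀ r z, α r z = min 1 (tensorFun μ (edgeFlowSwap (φ r) 0 (κ r).succ z) / tensorFun μ z))
    {Q : (Fin (K + 1) → S) × (Fin (K + 1) → S) → (Fin (K + 1) → S) × (Fin (K + 1) → S) → ℝ}
    (hQ : ∀ a b, Q a b =
      ∑ r : Fin m, t / m *
        (min (α r a.1) (α r a.2) * (if b.1 = edgeFlowSwap (φ r) 0 (κ r).succ a.1
              ∧ b.2 = edgeFlowSwap (φ r) 0 (κ r).succ a.2 then (1 : ℝ) else 0)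
          + (α r a.1 - min (α r a.1) (α r a.2)) * (if b.1 = edgeFlowSwap (φ r) 0 (κ r).succ a.1 ∧ b.2 = a.2
              then (1 : ℝ) else 0)
          + (α r a.2 - min (α r a.1) (α r a.2)) * (if b.1 = a.1 ∧ b.2 = edgeFlowSwap (φ r) 0 (κ r).succ a.2
              then (1 : ℝ) else 0)
          + (1 - α r a.1 - α r a.2 + min (α r a.1) (α r a.2)) * (if b.1 = a.1 ∧ b.2 = a.2 then (1 : ℝ) else 0))
      + (1 - t) * ∑ k : Fin (K + 1), w k *
        (if a.1 k = a.2 k ∨ k = 0 then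
            ∑ v : S, M k (a.1 k) v * (if b.1 = update a.1 k v ∧ b.2 = update a.2 k v then (1 : ℝ) else 0)
          else coordKernel M k a.1 b.1 * coordKernel M k a.2 b.2))
    {R : (Fin (K + 1) → S) × (Fin (K + 1) → S) → (Fin (K + 1) → S) × (Fin (K + 1) → S) → ℝ}
    (hR : ∀ a b, R a b = ∑ v : S, μ 0 v * (if b.1 = update a.1 0 v ∧ b.2 = update a.2 0 v then (1 : ℝ) else 0))
    {M' : (Fin (K + 1) → S) × (Fin (K + 1) → S) → (Fin (K + 1) → S) × (Fin (K + 1) → S) → ℝ}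
    (hM' : ∀ a b, M' a b = Q a b - (1 - t) * w 0 * R a b)
    {ind : (Fin (K + 1) → S) × (Fin (K + 1) → S) → ℝ} (hind : ∀ a, ind a = if a.1 = a.2 then 0 else 1)
    {Ψ : (Fin (K + 1) → S) × (Fin (K + 1) → S) → ℝ} {Ψmax ρ : ℝ} (hΨ0 : ∀ a, 0 ≤ Ψ a) (hΨmax : ∀ a, Ψ a ≤ Ψmax)
    (hΨ1 : ∀ a : (Fin (K + 1) → S) × (Fin (K + 1) → S), (∃ i : Fin K, a.1 i.succ ≠ a.2 i.succ) → 1 ≤ Ψ a) (hρ0 : 0 < ρ) (hρ1 : ρ ≤ 1)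
    {F : (Fin (K + 1) → S) × (Fin (K + 1) → S) → ℝ} (hF0 : ∀ a, 0 ≤ F a)
    (hbr : ∀ a : (Fin (K + 1) → S) × (Fin (K + 1) → S),
      (1 - t) * w 0 * Ψ a
        + ∑ r : Fin m, t / m *
          (min (α r a.1) (α r a.2) * F (edgeFlowSwap (φ r) 0 (κ r).succ a.1, edgeFlowSwap (φ r) 0 (κ r).succ a.2)
            + (α r a.1 - min (α r a.1) (α r a.2)) * F (edgeFlowSwap (φ r) 0 (κ r).succ a.1, a.2)
            + (α r a.2 - min (α r a.1) (α r a.2)) * F (a.1, edgeFlowSwap (φ r) 0 (κ r).succ a.2)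
            + (1 - α r a.1 - α r a.2 + min (α r a.1) (α r a.2)) * F (a.1, a.2))
      ≤ (t + (1 - t) * w 0) * F a)
    (hRF : ∀ a, (Matrix.mulVec (fun a b => R a b) F) a ≤ (1 - ρ) * Ψ a) {ε : ℝ} (hε : 0 < ε) :
    mixingTime (fun y z : Fin (K + 1) → S =>
        t * ptGraphSwap μ (fun r : Fin m => (((0 : Fin (K + 1)), (κ r).succ) : Fin (K + 1) × Fin (K + 1))) φ y z
          + (1 - t) * prodKernel w M y z) (tensorFun μ) ε
      ≤ ⌈1 / ((1 - t) * w 0 * ρ / 4) * Real.log ((Real.exp 1 * Ψmax + 1) / ε)⌉₊ :=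
  starCycle_mixingTime_le_of_supersolution κ φ hm ht0 ht1 hw0 hw00 hw1 hμ hμ1 hM hMrev hM0 hα hQ hR hM' hind hΨ0 hΨmax hΨ1 hρ0 hρ1 hF0
    (starSync_idle_supersolution_of κ φ hw1 hM0 hidle hQ hR hM' hbr) hRF hε

end Law

end Summit.Ventures.LatticeQCDFlow.Scaling

end
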